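import Summits.QuantumFields.BalabanUV.Beta.HessKerSlotCurrency
import Summits.QuantumFields.BalabanUV.Beta.FP.RoadRowD1
/-!
# `BalabanUV.Beta.HessKerSlotCurrencyRowD1` — part B of the SLOT-CURRENCY ladder: the split wall socket of `HessKerSlotCurrency` (part A)
# INSTANTIATED AT THE LITERAL OF RECORD `RowD1JointEnd.JsRowD1 hLc N cΛ cB` (route (E); closed form `FP.RoadRowD1.TbalOf_JsRowD1`).
# asym1 GEN 52 (author; unit `b2b-balaban-beta-asym1-g52`) — filed by courier `b2b-balaban-beta-lit1-g31`; answers gan24-p1-g13's repair (iv)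
# (journal l.19006), ref2 RULING R119-2 (β) (l.19303) and an2-g22's R-D1-g22-3(a) (l.19641); binder RULING R-asym1-g52-1 (journal l.19817).

HONEST DEPENDENCY (page 1, mandatory): continuum YM on T⁴ ⇐ BetaPertH ∧ nine spine estimates (0/9 proved); BetaPertH ⇐ (D1) ∧ (D4) ∧
CAP+tail; G-an2-4 gates asym, D1 and NE2/3/4.  HONEST FRAMING (cell contract, verbatim): «discharging `BetaPertH` makes Bałaban's UV
stability UNCONDITIONAL — a real constructive-QFT result; it is NOT the continuum limit and NOT the Clay problem.»  THIS MODULE is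
bookkeeping ∕ plumbing ([folklore] kernel algebra + composition BY NAME of tree theorems): no `def`, no `def … : Prop`, nothing cited as a
fact, 0 sorry; EVERY row ∕ letter of every END below is a HYPOTHESIS SHAPE, universally bound, never asserted for Bałaban's objects; the module
discharges NOTHING of `BetaPertH`: NOT an estimate, NOT D1, NEVER «G-an2-4 closed», NOT (CONV-C), NOT BetaPertH, NOT continuum, NOT Clay.
ABSOLUTE RULE (cell charter, verbatim): «No internally-minted statement may enter as a cited fact. Every hypothesis is either kernel-proved in
this package or a verbatim quotation of a PUBLISHED theorem with page reference. The manuscript(s) under audit are NOT citable for their own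
disputed steps — they are the thing under adjudication; programme-internal (2001/route/tribunal) claims are never citable.»

CONTENT (with `G_j := coDressKBmAt (toSite (ctrOff 4 Lc)) Lc (KInvStep Lc j)` an2's co-dressed one-step resolvent and `S⁰_j`∕`W⁰_j` the undressed
recursive tables `FP.RoadRowD1.JsRowD1Undressed`; every S-∕W-∕K-letter below is a HYPOTHESIS):
* **`d1Drift_JsRowD1_iff_of_halfKernel_letters`** — both slots in HALF-KERNEL currency (L2): uniform + all-scales letters of the W-half
  `j ↦ hessKer G_j 0 W⁰_j` and of the S-half `j ↦ hessKer G_j (vertexOfK G_j Lc S⁰_j) 0` ⟹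
  `D1Drift Lc (JsRowD1 …) Nc μ ν ↔ secondMoment (limKernelOf W-half) μ ν + secondMoment (limKernelOf S-half) μ ν = stepBal Nc Lc`
  (no units, no pins, no K-row, no window); `allScalesSeq_JsRowD1_of_halfKernel_letters` (existence side: the `hball` letter).
* **`d1Drift_JsRowD1_iff_of_vertexRows`** — S-slot in VERTEX currency (L1: `VertexFamily` rows of the assembled, unit-rescaled vertex), K- and
  W-slots entrywise as in the template, any nonzero units, ONE rate and window; **`…_of_vertexRowsW`** (all three slots in the weighted classes);
  the consistency bridge **`…_of_stencilRowsW`** (today's L0 stencil rows ⟹ the same conclusion — nothing filed is retracted).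
* **`d1Drift_JsRowD1_iff_of_vertexRows_bm`** — the adopted units `Lc^j`, `Lc^{4j}`; K-slot DISCHARGED by `FP.RoadRebasedHoldsBm.bmRows_holds`;
  S-vertex rows and W-table rows at their own rates — the literal twin of `HessKerCoDressedBmWallRec.d1Drift_JsRowD1_iff_of_slots` with
  `hS`∕`hSall` ↦ `hV`∕`hVall`, the constructed-limit side named by the two limit HALF-KERNELS.
WHAT IS NOT HERE: which rung Bałaban's objects satisfy (row owner); any estimate; the identification with `stepBal` (road FP ∕ D1 level) — for road
FP: its perfect objects `SPerfOf`∕`WPerfOf` are entrywise limits (`limStOf`∕`limTabOf`), so in L2 the S∕W perfect objects are the limit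
HALF-KERNELS `limKernelOf …` instead (`HessKerSlotCurrency.lim_secondMoment_eq_limKernelOf`).  NOT «D1 closed»; NEVER «G-an2-4 closed».
-/
noncomputable section

namespace Summit.QuantumFields.BalabanUV.Beta.HessKerSlotCurrencyRowD1

open Finset Filter Topology
open scoped BigOperators
open Literature.MathematicalPhysics.QuantumFieldTheory.Balaban1983to89
open Literature.MathematicalPhysics.QuantumFieldTheory.Balaban1983to89.Beta
open B12Sec2to5 (Decay510 betaPrime510 secondMoment_abs_le_of_decay510)
open B12Beta (secondMoment)
open B12Normalization (stepBal)
open ExpKernelCalculus (MKer Decays BiLoc VertexFamily VertexFamily₂ hessKer tadpole bubble comp tr Zl)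
open LimitRate (UniformDecay GeometricRate StepRate limKernelOf subKernel)
open HessKerRate (biLoc_zero)
open HessKerSchur (ColW BiW VertexFamilyW VertexFamily₂W hessW lipW LocStencilW colW_of_decays locStencilW_of_locStencil
  vertexFamilyW_of_vertexFamily vertexFamily₂W_of_vertexFamily₂ uniformDecay_hessKer_halfV vertexFamilyW_vertexOfK)
open HessKerSchurCauchy (AllScalesRate allScalesRate_hessKer_halfV vertexFamilyW_vertexOfK_allScales)
open RemainderConstAllScales (AllScalesSeq allScalesSeq_secondMoment allScalesSeq_secondMoment_of_summable)
open RateCertificate (GeomRate CauchyRate)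
open OneStepResolventKernel (Fib LocStencil JetData)
open OneStepKernelFamily (vertexOfK KInvStep TbalOf D1Drift)
open HessKerDressedCauchy (d1Drift_iff_lim_eq one_le_Lc)
open AffineAveraging (toSite)
open AveragingContoursRooted (ctrOff ctrOff_mem_box)
open Summit.QuantumFields.BalabanUV.Beta.HessKerDressedUnits (unitK unitS unitW)
open Summit.QuantumFields.BalabanUV.Beta.HessKerFourFamily (hessKer_four_unit)
open Summit.QuantumFields.BalabanUV.Beta.AxialDressingRooted (coDressKBmAt)
open Summit.QuantumFields.BalabanUV.Beta.GAN24.CombesThomas (sfStep smStep sfStep_ne_zero smStep_ne_zero)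
open Summit.QuantumFields.BalabanUV.Beta.RowD1JointEnd (JsRowD1)
open Summit.QuantumFields.BalabanUV.Beta.FP.RoadRowD1 (JsRowD1Undressed TbalOf_JsRowD1)
open Summit.QuantumFields.BalabanUV.Beta.HessKerConvCKPlug (biLoc_mono' decays_rows_rate_le vertexFamily₂_rows_rate_le)
open Summit.QuantumFields.BalabanUV.Beta.FP.RoadRebasedHoldsBm (GBm GBm_one bmRows_holds)
open Summit.QuantumFields.BalabanUV.Beta.HessKerSlotCurrency

/-! ## §5 AT THE LITERAL OF RECORD `JsRowD1` (route (E)): the wall ⟺ the identification, slot letters in the weaker currencies -/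

section Literal

variable {Lc : ℕ} [NeZero Lc] (hLc : Odd Lc) (N : ℕ) (cΛ cB : ℝ)

/-- **(β) THE WALL SOCKET AT THE LITERAL OF RECORD, BOTH SLOTS IN HALF-KERNEL CURRENCY (L2)** [our object; bookkeeping].  With
`G_j := coDressKBmAt ρ_c Lc (KInvStep Lc j)` (an2's co-dressed one-step resolvent), `S⁰_j`∕`W⁰_j` the undressed recursive tables of `JsRowD1`
(`FP.RoadRowD1.JsRowD1Undressed`), `V_j := vertexOfK G_j Lc S⁰_j`: IF the W-HALF `j ↦ hessKer G_j 0 W⁰_j` (`½·Tr[G_j ∘ W⁰_j(0,·)]`) and the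
S-HALF `j ↦ hessKer G_j V_j 0` (`−½·Tr[(G_j∘V_j(0))(G_j∘V_j(·))]`) each carry a uniform letter and an all-scales letter in the `(μ,ν)` component
(HYPOTHESES — the proposed S-∕W-slot binders of record for (E); NOT in print, never asserted), THEN
`D1Drift Lc (JsRowD1 …) Nc μ ν ↔ secondMoment (limKernelOf W-half) μ ν + secondMoment (limKernelOf S-half) μ ν = stepBal Nc Lc`.
No units, no pins, no K-row, no window (`FP.RoadRowD1.TbalOf_JsRowD1` + §3).  NOT «D1 closed»; discharges nothing. -/
theorem d1Drift_JsRowD1_iff_of_halfKernel_letters {μ ν : Fin 4} {CW δW cW δW' CS δS cS δS' θ : ℝ}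
    (hWu : UniformDecay (fun j => hessKer (coDressKBmAt (toSite (ctrOff (3 + 1) Lc)) Lc (KInvStep (d := 3) Lc j)) 0
      (JsRowD1Undressed hLc N cΛ cB j).W) μ ν CW δW)
    (hWa : AllScalesRate (fun j => hessKer (coDressKBmAt (toSite (ctrOff (3 + 1) Lc)) Lc (KInvStep (d := 3) Lc j)) 0
      (JsRowD1Undressed hLc N cΛ cB j).W) μ ν cW δW' θ)
    (hSu : UniformDecay (fun j => hessKer (coDressKBmAt (toSite (ctrOff (3 + 1) Lc)) Lc (KInvStep (d := 3) Lc j))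
      (vertexOfK (coDressKBmAt (toSite (ctrOff (3 + 1) Lc)) Lc (KInvStep (d := 3) Lc j)) Lc (JsRowD1Undressed hLc N cΛ cB j).S) 0) μ ν CS δS)
    (hSa : AllScalesRate (fun j => hessKer (coDressKBmAt (toSite (ctrOff (3 + 1) Lc)) Lc (KInvStep (d := 3) Lc j))
      (vertexOfK (coDressKBmAt (toSite (ctrOff (3 + 1) Lc)) Lc (KInvStep (d := 3) Lc j)) Lc (JsRowD1Undressed hLc N cΛ cB j).S) 0) μ ν cS δS' θ)
    (hδW : 0 < δW) (hδW' : 0 < δW') (hδS : 0 < δS) (hδS' : 0 < δS') (hθ0 : 0 ≤ θ) (hθ1 : θ < 1) (Nc : ℝ) :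
    D1Drift Lc (JsRowD1 hLc N cΛ cB) Nc μ ν ↔
      secondMoment (limKernelOf fun j => hessKer (coDressKBmAt (toSite (ctrOff (3 + 1) Lc)) Lc (KInvStep (d := 3) Lc j)) 0
          (JsRowD1Undressed hLc N cΛ cB j).W) μ ν +
        secondMoment (limKernelOf fun j => hessKer (coDressKBmAt (toSite (ctrOff (3 + 1) Lc)) Lc (KInvStep (d := 3) Lc j))
          (vertexOfK (coDressKBmAt (toSite (ctrOff (3 + 1) Lc)) Lc (KInvStep (d := 3) Lc j)) Lc (JsRowD1Undressed hLc N cΛ cB j).S) 0) μ ν =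
        stepBal Nc Lc :=
  d1Drift_iff_of_halfKernel_letters (JsRowD1 hLc N cΛ cB) (TbalOf_JsRowD1 hLc N cΛ cB) hWu hWa hSu hSa hδW hδW' hδS hδS' hθ0 hθ1 Nc

/-- **EXISTENCE SIDE AT THE LITERAL OF RECORD IN HALF-KERNEL CURRENCY** [our object; bookkeeping]: the four L2 letters give the all-scales bound
of `j ↦ Σ_z z_μ z_ν TbalOf Lc (JsRowD1 …) j z` with `κ = β′(c_W, δ_W′) + β′(c_S, δ_S′)` — the `hball` letter of road FP ∕ BF-x for the literal.  HYPOTHESES;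
discharges nothing. -/
theorem allScalesSeq_JsRowD1_of_halfKernel_letters {μ ν : Fin 4} {CW δW cW δW' CS δS cS δS' θ : ℝ}
    (hWu : UniformDecay (fun j => hessKer (coDressKBmAt (toSite (ctrOff (3 + 1) Lc)) Lc (KInvStep (d := 3) Lc j)) 0
      (JsRowD1Undressed hLc N cΛ cB j).W) μ ν CW δW)
    (hWa : AllScalesRate (fun j => hessKer (coDressKBmAt (toSite (ctrOff (3 + 1) Lc)) Lc (KInvStep (d := 3) Lc j)) 0
      (JsRowD1Undressed hLc N cΛ cB j).W) μ ν cW δW' θ)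
    (hSu : UniformDecay (fun j => hessKer (coDressKBmAt (toSite (ctrOff (3 + 1) Lc)) Lc (KInvStep (d := 3) Lc j))
      (vertexOfK (coDressKBmAt (toSite (ctrOff (3 + 1) Lc)) Lc (KInvStep (d := 3) Lc j)) Lc (JsRowD1Undressed hLc N cΛ cB j).S) 0) μ ν CS δS)
    (hSa : AllScalesRate (fun j => hessKer (coDressKBmAt (toSite (ctrOff (3 + 1) Lc)) Lc (KInvStep (d := 3) Lc j))
      (vertexOfK (coDressKBmAt (toSite (ctrOff (3 + 1) Lc)) Lc (KInvStep (d := 3) Lc j)) Lc (JsRowD1Undressed hLc N cΛ cB j).S) 0) μ ν cS δS' θ)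
    (hδW : 0 < δW) (hδW' : 0 < δW') (hδS : 0 < δS) (hδS' : 0 < δS') :
    AllScalesSeq (fun j => secondMoment (TbalOf Lc (JsRowD1 hLc N cΛ cB) j) μ ν) (betaPrime510 (3 + 1) cW δW' + betaPrime510 (3 + 1) cS δS') θ :=
  allScalesSeq_secondMoment_TbalOf_of_halves (JsRowD1 hLc N cΛ cB) (TbalOf_JsRowD1 hLc N cΛ cB) hWu hWa hSu hSa hδW hδW' hδS hδS'

variable (sf sm : ℕ → ℝ)

/-- [our object] The closed form of the literal's wall kernels in unit currency (`TbalOf_JsRowD1` + `HessKerFourFamily.hessKer_four_unit`). -/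
theorem TbalOf_JsRowD1_unit (hsf : ∀ j, sf j ≠ 0) (hsm : ∀ j, sm j ≠ 0) (j : ℕ) :
    TbalOf Lc (JsRowD1 hLc N cΛ cB) j =
      hessKer (unitK (sf j) (sm j) (coDressKBmAt (toSite (ctrOff (3 + 1) Lc)) Lc (KInvStep (d := 3) Lc j)))
        (vertexOfK (unitK (sf j) (sm j) (coDressKBmAt (toSite (ctrOff (3 + 1) Lc)) Lc (KInvStep (d := 3) Lc j))) Lc
          (unitS (sf j) (sm j) (JsRowD1Undressed hLc N cΛ cB j).S))
        (unitW (sf j) (sm j) (JsRowD1Undressed hLc N cΛ cB j).W) := by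
  rw [TbalOf_JsRowD1, hessKer_four_unit (hsf j) (hsm j)]

/-- **THE WALL ⟺ THE IDENTIFICATION AT THE LITERAL OF RECORD, S-SLOT IN VERTEX CURRENCY (L1), W- AND K-SLOTS ENTRYWISE (L0)** [our object;
bookkeeping] — `HessKerCoDressedBmWall(Rec)` §3 ∕ road FP's residual with EXACTLY ONE CHANGE: the two S-slot rows `hS`∕`hSall` (`LocStencil` of the
unit-rescaled stencil tables) are REPLACED by two rows `hV`∕`hVall` on the ASSEMBLED unit-rescaled vertex
`V_j := vertexOfK (unitK (sf j) (sm j) G_j) Lc (unitS (sf j) (sm j) S⁰_j)` (`VertexFamily`, uniform + all-scales, rate `δV`, window `R/2 < δV`);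
any nonzero unit sequences `sf, sm`; ONE rate `θ` and ONE window `R` for the three slots (merge beforehand with §2 ∕ `HessKerConvCKPlug`).  The
constructed-limit side is named through the two limit HALF-KERNELS.  The old rows imply the new ones (`vertexRows_of_stencilRows`;
`d1Drift_JsRowD1_iff_of_stencilRowsW`).  NOT «D1 closed»; discharges nothing. -/
theorem d1Drift_JsRowD1_iff_of_vertexRows (hsf : ∀ j, sf j ≠ 0) (hsm : ∀ j, sm j ≠ 0) {R C cK δK Cv cV δV Cw cW δW θ : ℝ}
    (hK : ∀ j, Decays (unitK (sf j) (sm j) (coDressKBmAt (toSite (ctrOff (3 + 1) Lc)) Lc (KInvStep (d := 3) Lc j))) C δK)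
    (hKall : ∀ k j, Decays (unitK (sf (k + j)) (sm (k + j)) (coDressKBmAt (toSite (ctrOff (3 + 1) Lc)) Lc (KInvStep (d := 3) Lc (k + j))) -
      unitK (sf k) (sm k) (coDressKBmAt (toSite (ctrOff (3 + 1) Lc)) Lc (KInvStep (d := 3) Lc k))) (cK * θ ^ k) δK)
    (hV : ∀ j, VertexFamily (vertexOfK (unitK (sf j) (sm j) (coDressKBmAt (toSite (ctrOff (3 + 1) Lc)) Lc (KInvStep (d := 3) Lc j))) Lc
      (unitS (sf j) (sm j) (JsRowD1Undressed hLc N cΛ cB j).S)) Lc Cv δV)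
    (hVall : ∀ k j, VertexFamily
      (vertexOfK (unitK (sf (k + j)) (sm (k + j)) (coDressKBmAt (toSite (ctrOff (3 + 1) Lc)) Lc (KInvStep (d := 3) Lc (k + j)))) Lc
          (unitS (sf (k + j)) (sm (k + j)) (JsRowD1Undressed hLc N cΛ cB (k + j)).S) -
        vertexOfK (unitK (sf k) (sm k) (coDressKBmAt (toSite (ctrOff (3 + 1) Lc)) Lc (KInvStep (d := 3) Lc k))) Lc
          (unitS (sf k) (sm k) (JsRowD1Undressed hLc N cΛ cB k).S)) Lc (cV * θ ^ k) δV)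
    (hW : ∀ j, VertexFamily₂ (unitW (sf j) (sm j) (JsRowD1Undressed hLc N cΛ cB j).W) Lc Cw δW)
    (hWall : ∀ k j, VertexFamily₂ (unitW (sf (k + j)) (sm (k + j)) (JsRowD1Undressed hLc N cΛ cB (k + j)).W -
      unitW (sf k) (sm k) (JsRowD1Undressed hLc N cΛ cB k).W) Lc (cW * θ ^ k) δW)
    (hR : 0 < R) (hRK : R < δK) (hRV : R / 2 < δV) (hRW : R < δW) (hθ0 : 0 ≤ θ) (hθ1 : θ < 1) (μ ν : Fin 4) (Nc : ℝ) :
    D1Drift Lc (JsRowD1 hLc N cΛ cB) Nc μ ν ↔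
      secondMoment (limKernelOf fun j => hessKer (unitK (sf j) (sm j) (coDressKBmAt (toSite (ctrOff (3 + 1) Lc)) Lc (KInvStep (d := 3) Lc j))) 0
          (unitW (sf j) (sm j) (JsRowD1Undressed hLc N cΛ cB j).W)) μ ν +
        secondMoment (limKernelOf fun j => hessKer (unitK (sf j) (sm j) (coDressKBmAt (toSite (ctrOff (3 + 1) Lc)) Lc (KInvStep (d := 3) Lc j)))
          (vertexOfK (unitK (sf j) (sm j) (coDressKBmAt (toSite (ctrOff (3 + 1) Lc)) Lc (KInvStep (d := 3) Lc j))) Lc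
            (unitS (sf j) (sm j) (JsRowD1Undressed hLc N cΛ cB j).S)) 0) μ ν =
        stepBal Nc Lc := by
  have hLc1 : (1 : ℝ) ≤ (Lc : ℝ) := by exact_mod_cast (one_le_Lc (Lc := Lc))
  have hRN : 0 < R * (Lc : ℝ) := mul_pos hR (by linarith)
  exact d1Drift_iff_of_halfKernel_letters (JsRowD1 hLc N cΛ cB) (TbalOf_JsRowD1_unit hLc N cΛ cB sf sm hsf hsm)
    (uniformDecay_halfW_of_entrywise hK hW hR.le hRK hRW μ ν) (allScalesRate_halfW_of_entrywise hK hKall hW hWall hR hRK hRW μ ν)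
    (uniformDecay_halfS_of_vertexRows hK hV hR.le hRK hRV μ ν) (allScalesRate_halfS_of_vertexRows hK hKall hV hVall hR hRK hRV μ ν)
    hRN hRN hRN hRN hθ0 hθ1 Nc

/-- **THE SAME, ALL THREE SLOTS IN THE WEIGHTED ROW CLASSES** [our object; bookkeeping]: K-slot `ColW` rows, S-slot `VertexFamilyW` rows on the
assembled unit-rescaled vertex at weight `R/2` (L1), W-slot `VertexFamily₂W` rows at weight `R`; ONE rate `θ ∈ [0,1)`, ONE weight `R > 0`, any
nonzero units.  (The weighted classes are what the Schur ∕ Lipschitz engine `HessKerSchur(Cauchy)` consumes; entrywise rows imply them: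
`colW_of_decays`, `vertexFamilyW_of_vertexFamily`, `vertexFamily₂W_of_vertexFamily₂`; stencil rows imply the vertex rows: `vertexRows_of_stencilRows`.) -/
theorem d1Drift_JsRowD1_iff_of_vertexRowsW (hsf : ∀ j, sf j ≠ 0) (hsm : ∀ j, sm j ≠ 0) {R BK cK BV cV BW cW θ : ℝ}
    (hK : ∀ j, ColW (unitK (sf j) (sm j) (coDressKBmAt (toSite (ctrOff (3 + 1) Lc)) Lc (KInvStep (d := 3) Lc j))) R BK)
    (hKall : ∀ k j, ColW (unitK (sf (k + j)) (sm (k + j)) (coDressKBmAt (toSite (ctrOff (3 + 1) Lc)) Lc (KInvStep (d := 3) Lc (k + j))) -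
      unitK (sf k) (sm k) (coDressKBmAt (toSite (ctrOff (3 + 1) Lc)) Lc (KInvStep (d := 3) Lc k))) R (cK * θ ^ k))
    (hV : ∀ j, VertexFamilyW (vertexOfK (unitK (sf j) (sm j) (coDressKBmAt (toSite (ctrOff (3 + 1) Lc)) Lc (KInvStep (d := 3) Lc j))) Lc
      (unitS (sf j) (sm j) (JsRowD1Undressed hLc N cΛ cB j).S)) Lc (R / 2) BV)
    (hVall : ∀ k j, VertexFamilyW
      (vertexOfK (unitK (sf (k + j)) (sm (k + j)) (coDressKBmAt (toSite (ctrOff (3 + 1) Lc)) Lc (KInvStep (d := 3) Lc (k + j)))) Lc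
          (unitS (sf (k + j)) (sm (k + j)) (JsRowD1Undressed hLc N cΛ cB (k + j)).S) -
        vertexOfK (unitK (sf k) (sm k) (coDressKBmAt (toSite (ctrOff (3 + 1) Lc)) Lc (KInvStep (d := 3) Lc k))) Lc
          (unitS (sf k) (sm k) (JsRowD1Undressed hLc N cΛ cB k).S)) Lc (R / 2) (cV * θ ^ k))
    (hW : ∀ j, VertexFamily₂W (unitW (sf j) (sm j) (JsRowD1Undressed hLc N cΛ cB j).W) Lc R BW)
    (hWall : ∀ k j, VertexFamily₂W (unitW (sf (k + j)) (sm (k + j)) (JsRowD1Undressed hLc N cΛ cB (k + j)).W -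
      unitW (sf k) (sm k) (JsRowD1Undressed hLc N cΛ cB k).W) Lc R (cW * θ ^ k))
    (hR : 0 < R) (hθ0 : 0 ≤ θ) (hθ1 : θ < 1) (μ ν : Fin 4) (Nc : ℝ) :
    D1Drift Lc (JsRowD1 hLc N cΛ cB) Nc μ ν ↔
      secondMoment (limKernelOf fun j => hessKer (unitK (sf j) (sm j) (coDressKBmAt (toSite (ctrOff (3 + 1) Lc)) Lc (KInvStep (d := 3) Lc j))) 0
          (unitW (sf j) (sm j) (JsRowD1Undressed hLc N cΛ cB j).W)) μ ν +
        secondMoment (limKernelOf fun j => hessKer (unitK (sf j) (sm j) (coDressKBmAt (toSite (ctrOff (3 + 1) Lc)) Lc (KInvStep (d := 3) Lc j)))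
          (vertexOfK (unitK (sf j) (sm j) (coDressKBmAt (toSite (ctrOff (3 + 1) Lc)) Lc (KInvStep (d := 3) Lc j))) Lc
            (unitS (sf j) (sm j) (JsRowD1Undressed hLc N cΛ cB j).S)) 0) μ ν =
        stepBal Nc Lc := by
  have hLc1 : (1 : ℝ) ≤ (Lc : ℝ) := by exact_mod_cast (one_le_Lc (Lc := Lc))
  have hRN : 0 < R * (Lc : ℝ) := mul_pos hR (by linarith)
  exact d1Drift_iff_of_halfKernel_letters (JsRowD1 hLc N cΛ cB) (TbalOf_JsRowD1_unit hLc N cΛ cB sf sm hsf hsm)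
    (uniformDecay_halfW hK hW hR.le μ ν) (allScalesRate_halfW hK hKall hW hWall hR μ ν) (uniformDecay_halfS hK hV hR.le μ ν)
    (allScalesRate_halfS hK hKall hV hVall hR μ ν) hRN hRN hRN hRN hθ0 hθ1 Nc

/-- **CONSISTENCY WITH TODAY'S CURRENCY** [our object; bookkeeping]: the S-slot rows in the (weighted) ENTRYWISE stencil class `LocStencilW` at
weight `R/2` (L0 — the weighted form of today's `hS`∕`hSall`) imply the vertex rows (L1) BY NAME (`vertexRows_of_stencilRows`), hence feed the same
END with the same conclusion: re-typing the S-slot one rung down retracts nothing already filed. -/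
theorem d1Drift_JsRowD1_iff_of_stencilRowsW (hsf : ∀ j, sf j ≠ 0) (hsm : ∀ j, sm j ≠ 0) {R BK cK Bs cS BW cW θ : ℝ}
    (hK : ∀ j, ColW (unitK (sf j) (sm j) (coDressKBmAt (toSite (ctrOff (3 + 1) Lc)) Lc (KInvStep (d := 3) Lc j))) R BK)
    (hKall : ∀ k j, ColW (unitK (sf (k + j)) (sm (k + j)) (coDressKBmAt (toSite (ctrOff (3 + 1) Lc)) Lc (KInvStep (d := 3) Lc (k + j))) -
      unitK (sf k) (sm k) (coDressKBmAt (toSite (ctrOff (3 + 1) Lc)) Lc (KInvStep (d := 3) Lc k))) R (cK * θ ^ k))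
    (hS : ∀ j, LocStencilW (unitS (sf j) (sm j) (JsRowD1Undressed hLc N cΛ cB j).S) (R / 2) Bs)
    (hSall : ∀ k j, LocStencilW (unitS (sf (k + j)) (sm (k + j)) (JsRowD1Undressed hLc N cΛ cB (k + j)).S -
      unitS (sf k) (sm k) (JsRowD1Undressed hLc N cΛ cB k).S) (R / 2) (cS * θ ^ k))
    (hW : ∀ j, VertexFamily₂W (unitW (sf j) (sm j) (JsRowD1Undressed hLc N cΛ cB j).W) Lc R BW)
    (hWall : ∀ k j, VertexFamily₂W (unitW (sf (k + j)) (sm (k + j)) (JsRowD1Undressed hLc N cΛ cB (k + j)).W -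
      unitW (sf k) (sm k) (JsRowD1Undressed hLc N cΛ cB k).W) Lc R (cW * θ ^ k))
    (hR : 0 < R) (hθ0 : 0 ≤ θ) (hθ1 : θ < 1) (μ ν : Fin 4) (Nc : ℝ) :
    D1Drift Lc (JsRowD1 hLc N cΛ cB) Nc μ ν ↔
      secondMoment (limKernelOf fun j => hessKer (unitK (sf j) (sm j) (coDressKBmAt (toSite (ctrOff (3 + 1) Lc)) Lc (KInvStep (d := 3) Lc j))) 0
          (unitW (sf j) (sm j) (JsRowD1Undressed hLc N cΛ cB j).W)) μ ν +
        secondMoment (limKernelOf fun j => hessKer (unitK (sf j) (sm j) (coDressKBmAt (toSite (ctrOff (3 + 1) Lc)) Lc (KInvStep (d := 3) Lc j)))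
          (vertexOfK (unitK (sf j) (sm j) (coDressKBmAt (toSite (ctrOff (3 + 1) Lc)) Lc (KInvStep (d := 3) Lc j))) Lc
            (unitS (sf j) (sm j) (JsRowD1Undressed hLc N cΛ cB j).S)) 0) μ ν =
        stepBal Nc Lc := by
  obtain ⟨hV, hVall⟩ := vertexRows_of_stencilRows (K := fun j => unitK (sf j) (sm j) (coDressKBmAt (toSite (ctrOff (3 + 1) Lc)) Lc (KInvStep (d := 3) Lc j)))
    (S := fun j => unitS (sf j) (sm j) (JsRowD1Undressed hLc N cΛ cB j).S) hK hKall hS hSall hR Lc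
  exact d1Drift_JsRowD1_iff_of_vertexRowsW hLc N cΛ cB sf sm hsf hsm hK hKall hV hVall hW hWall hR hθ0 hθ1 μ ν Nc

/-- **THE L1 END AT THE ADOPTED UNITS WITH THE K-SLOT DISCHARGED** [our object; K-rows = `FP.RoadRebasedHoldsBm.bmRows_holds` (m := 1), i.e.
gan24-p1's `kSlotJM_holds` + an2's co-dressed block-mean rows, BY NAME]: at the units of record `sf_j = Lc^j`, `sm_j = Lc^4j` the wall at the literal
`JsRowD1` is equivalent to the identification, GIVEN ONLY the two S-slot VERTEX rows (`VertexFamily`, own rate `θ_V`, decay `δ_V > 0`) and the two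
W-slot table rows (`VertexFamily₂`, own rate `θ_W`, decay `δ_W > 0`) — the exact twin of the template's `d1Drift_JsRowD1_iff_of_slots` with
`hS`∕`hSall` ↦ `hV`∕`hVall`; rates and window merged inside.  HYPOTHESES, not assertions; NOT «D1 closed»; discharges nothing. -/
theorem d1Drift_JsRowD1_iff_of_vertexRows_bm (hLc2 : 2 ≤ Lc) {Cv cV δV θV Cw cW δW θW : ℝ}
    (hV : ∀ j, VertexFamily (vertexOfK (unitK (sfStep Lc j) (smStep 3 Lc j) (coDressKBmAt (toSite (ctrOff (3 + 1) Lc)) Lc (KInvStep (d := 3) Lc j))) Lc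
      (unitS (sfStep Lc j) (smStep 3 Lc j) (JsRowD1Undressed hLc N cΛ cB j).S)) Lc Cv δV)
    (hVall : ∀ k j, VertexFamily
      (vertexOfK (unitK (sfStep Lc (k + j)) (smStep 3 Lc (k + j)) (coDressKBmAt (toSite (ctrOff (3 + 1) Lc)) Lc (KInvStep (d := 3) Lc (k + j)))) Lc
          (unitS (sfStep Lc (k + j)) (smStep 3 Lc (k + j)) (JsRowD1Undressed hLc N cΛ cB (k + j)).S) -
        vertexOfK (unitK (sfStep Lc k) (smStep 3 Lc k) (coDressKBmAt (toSite (ctrOff (3 + 1) Lc)) Lc (KInvStep (d := 3) Lc k))) Lc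
          (unitS (sfStep Lc k) (smStep 3 Lc k) (JsRowD1Undressed hLc N cΛ cB k).S)) Lc (cV * θV ^ k) δV)
    (hW : ∀ j, VertexFamily₂ (unitW (sfStep Lc j) (smStep 3 Lc j) (JsRowD1Undressed hLc N cΛ cB j).W) Lc Cw δW)
    (hWall : ∀ k j, VertexFamily₂ (unitW (sfStep Lc (k + j)) (smStep 3 Lc (k + j)) (JsRowD1Undressed hLc N cΛ cB (k + j)).W -
      unitW (sfStep Lc k) (smStep 3 Lc k) (JsRowD1Undressed hLc N cΛ cB k).W) Lc (cW * θW ^ k) δW)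
    (hδV : 0 < δV) (hδW : 0 < δW) (hθV0 : 0 ≤ θV) (hθV1 : θV < 1) (hθW0 : 0 ≤ θW) (hθW1 : θW < 1) (μ ν : Fin 4) (Nc : ℝ) :
    D1Drift Lc (JsRowD1 hLc N cΛ cB) Nc μ ν ↔
      secondMoment (limKernelOf fun j => hessKer (unitK (sfStep Lc j) (smStep 3 Lc j) (coDressKBmAt (toSite (ctrOff (3 + 1) Lc)) Lc (KInvStep (d := 3) Lc j))) 0
          (unitW (sfStep Lc j) (smStep 3 Lc j) (JsRowD1Undressed hLc N cΛ cB j).W)) μ ν +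
        secondMoment (limKernelOf fun j => hessKer (unitK (sfStep Lc j) (smStep 3 Lc j) (coDressKBmAt (toSite (ctrOff (3 + 1) Lc)) Lc (KInvStep (d := 3) Lc j)))
          (vertexOfK (unitK (sfStep Lc j) (smStep 3 Lc j) (coDressKBmAt (toSite (ctrOff (3 + 1) Lc)) Lc (KInvStep (d := 3) Lc j))) Lc
            (unitS (sfStep Lc j) (smStep 3 Lc j) (JsRowD1Undressed hLc N cΛ cB j).S)) 0) μ ν =
        stepBal Nc Lc := by
  obtain ⟨C, δK, cK, θK, hδK, hθK0, hθK1, hK, hKall⟩ := bmRows_holds (Lc := Lc) hLc2 (ctrOff_mem_box hLc.pos) (m := 1) le_rfl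
  simp only [GBm_one] at hK hKall
  have hKall' := decays_rows_rate_le (A := fun j => unitK (sfStep Lc j) (smStep 3 Lc j) (coDressKBmAt (toSite (ctrOff (3 + 1) Lc)) Lc (KInvStep (d := 3) Lc j))) hKall hθK0
    (le_max_left θK (max θV θW))
  have hVall' := vertexFamily_rows_rate_le
    (V := fun j => vertexOfK (unitK (sfStep Lc j) (smStep 3 Lc j) (coDressKBmAt (toSite (ctrOff (3 + 1) Lc)) Lc (KInvStep (d := 3) Lc j))) Lc
      (unitS (sfStep Lc j) (smStep 3 Lc j) (JsRowD1Undressed hLc N cΛ cB j).S))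
    hVall hθV0 ((le_max_left θV θW).trans (le_max_right θK (max θV θW)))
  have hWall' := vertexFamily₂_rows_rate_le (W := fun j => unitW (sfStep Lc j) (smStep 3 Lc j) (JsRowD1Undressed hLc N cΛ cB j).W) hWall hθW0
    ((le_max_right θV θW).trans (le_max_right θK (max θV θW)))
  have h1 : min δK (min δV δW) ≤ δK := min_le_left _ _
  have h2 : min δK (min δV δW) ≤ δV := (min_le_right _ _).trans (min_le_left _ _)
  have h3 : min δK (min δV δW) ≤ δW := (min_le_right _ _).trans (min_le_right _ _)
  have h0 : 0 < min δK (min δV δW) := lt_min hδK (lt_min hδV hδW)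
  exact d1Drift_JsRowD1_iff_of_vertexRows hLc N cΛ cB (sfStep Lc) (smStep 3 Lc) sfStep_ne_zero smStep_ne_zero
    (R := min δK (min δV δW) / 2) hK hKall' hV hVall' hW hWall' (by linarith) (by linarith) (by linarith) (by linarith)
    (hθK0.trans (le_max_left _ _)) (max_lt hθK1 (max_lt hθV1 hθW1)) μ ν Nc

end Literal

end Summit.QuantumFields.BalabanUV.Beta.HessKerSlotCurrencyRowD1

end
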